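import Literature.NumberTheory.Rogawski1990.FinExplicitTransferFactorLeviStratum      -- ★ g6: `endoEmbLocal_eq_glDiagonal_of_fst_eq`, `endoEmbLocal_mem_torusU_of_endoEmbLocal_eq`, `eval_finCharpolyTwo_eq_of_endoEmbLocal_eq`; brings ★ `UnitaryGroupRegularTwistModulus`
import Literature.NumberTheory.Rogawski1990.FinExplicitTransferFactorTorusDockSplit     -- ★ `finTau_eq_of_frame`, `finHeckeValue_mul`
import Literature.NumberTheory.Rogawski1990.SemilocalQuadraticCharExtension             -- ★ `isQuadraticCharExtension_semilocalComponent_of_baseChange_eq`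
import Literature.NumberTheory.Rogawski1990.ExplicitFactorKappaAlmostEverywhereOne      -- ★ `conjLocal_finGammaTwo_mul_finGammaTwo`
import Literature.NumberTheory.Automorphic.UnitaryGroupLineBorelModulus                 -- ★ F0P2-p06 (g7): `rootDeltaChar_cmBorel_torus_two`
import Literature.NumberTheory.Automorphic.UnitaryGroupLineUnipotentRing                -- ★ `LineRing.torus_relations_two`
import Literature.NumberTheory.Rogawski1990.XiLocalCharacter                            -- ★ `localDet`, `coe_localDet`
import Summits.HodgeConjecture.HodgeConjecture.Theorems.F0P2oBorelTorusModulus           -- ★ `rootDeltaChar_cmBorel_torus` (`N = 3`)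
import HarnessLib

/-!
# The two DICTIONARIES of Lemma 4.9.2 on the LEVI stratum: modulus `δ_{B₂}^{1∕2} · J₂⁻¹ · D_{G∕H} = δ_B^{1∕2} · J₃⁻¹` and character `χ_H · τ_v = χ′|_T`
(Rogawski (1990), §4.9 Lemma 4.9.2 p. 56 and its proof («`D_H(γ)Φ(γ, f^H) = μ(γ)D_G(γ)Φ(γ, f)`», «`τ(γ) = μ(γ₁)`»); §12.1 p. 171; §12.2 p. 174)

Summit `HodgeConjecture`, crux H413 (`stmt-HodgeConjecture-24833`); cell `pub/hodgecm-mathlib`, line «CMCharIdentityTest» (F0P3b), desk F0P3b-plan (g12) PLAN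
v14 §10 — the S4 dictionaries (L2)∕(L3) of (N-492) `stub_inducedCharTransfer` (B-p18 (g32) «=» 08:31:49Z); seat F0P3b-p01 (g7).  THEOREMS ONLY (kernel lane,
`--supports stmt-HodgeConjecture-24833 --as helper`; a Theorems file because ★ `rootDeltaChar_cmBorel_torus` for `U(Φ₃)` lives in ★ `Theorems/F0P2oBorelTorusModulus`).
HONEST LABEL: HC_CM is proved only modulo the 2 remaining named inputs (hLiu418, h413) until rung 0 closes; this file pays no letter by itself.

SETTING.  `γ_H = (g, u) ∈ H_v = U(Φ₂)(L⁺_v) × U(Φ₁)(L⁺_v)` on the LEVI stratum: `g = diag(d′₀, d′₁)` (`hd'`), `ι_v(γ_H) = diag(d′₀, u, d′₁) ∈ T(L⁺_v)` (★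
`endoEmbLocal_eq_glDiagonal_of_fst_eq`), with `a − 1 := d′₀⁻¹u − 1` and `b − 1 := d′₀⁻¹d′₁ − 1` units (the twist data `ha hb` of ★ A-p12 ∕ ★ S0 FILE 2 ∕ ★ g6 FILE F).
* §1 (L3) **`rootDeltaChar_two_mul_sqrt_mul_finWeylRatio_eq`** — the MODULUS DICTIONARY, in the `unitModulusChar` currency reached by ★ `twistModule_cmLocal_eq` (`J₃(t)⁻¹ =
  ‖a − 1‖·√‖b − 1‖`) and ★ `twistModule_cmLocal_two_eq` (`J₂(g)⁻¹ = √‖b − 1‖`):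
  `δ_{B₂}^{1∕2}(g) · √‖b − 1‖ · D_{G∕H,v}(γ_H) = δ_B^{1∕2}(ι γ_H) · (‖a − 1‖ · √‖b − 1‖)` as complex numbers — both sides are `‖d′₀‖ · ‖a − 1‖ · √‖b − 1‖`
  (★ `rootDeltaChar_cmBorel_torus_two`: `δ_{B₂}^{1∕2}(g) = √‖d′₀‖`; ★ `rootDeltaChar_cmBorel_torus`: `δ_B^{1∕2}(ι γ_H) = ‖d′₀‖`; ★ `sqrt_prod_norm_weylNumerator_cmLocal`:
  `D_{G∕H,v}(γ_H) = ‖a − 1‖ · √‖d′₀‖`).  Print: `|D_H(γ)| · |D_{G∕H}(γ)| = |D_G(γ)|`.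
* §2 (L2, EDITION 2, append-only) the CHARACTER DICTIONARY: **`finTau_eq_finHeckeValue_of_levi`** — `τ_v(γ_H) = μ_v(d′₀)` on the stratum under «`μ|_{F_v^×} = ω`»
  (★ `IsQuadraticCharExtension`, from the global guard by ★ `isQuadraticCharExtension_semilocalComponent_of_baseChange_eq`; ★ `finTau_eq_of_frame` at the frame `P = 1`,
  the torus relations `σ(d′₀)d′₁ = 1`, `σ(u)u = 1`, norm-triviality `μ_v(σ(z)z) = 1`), and **`torusCharPair_mul_localDet_mul_finTau_eq_cmXiTorusChar`** —
  `χ_{H,2}(g) · (ψ ∘ det)(u) · τ_v(γ_H) = χ_ξ(ι γ_H)` for the stub's `H`-side torus character `χ_{H,2} = torusCharPair … 0 ((η ∘ quotConj) · ‖·‖^{1∕2}) ψ` and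
  `χ_ξ = cmXiTorusChar L v μ_v η ψ` («`τ(γ) = μ(γ₁)`», `ψ(det g)ψ(u) = ψ(det ι γ_H)`).  EDITION 1 = §0 + §1.

## References
* [Rogawski1990] J. D. Rogawski, *Automorphic Representations of Unitary Groups in Three Variables*, Ann. of Math. Stud. 123 (1990): §4.9 Lemma 4.9.2 p. 56
  and its proof; §12.1 p. 171; §12.2 p. 174; §4.8 p. 51.
* [vanDijk1972] G. van Dijk, *Computation of certain induced characters of 𝔭-adic groups*, Math. Ann. 199 (1972), 229–240.
-/

set_option autoImplicit false
set_option linter.dupNamespace false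

noncomputable section

open MeasureTheory Measure Set NumberField IsDedekindDomain Matrix
open Literature.NumberTheory.Automorphic Literature.NumberTheory.Automorphic.UnitaryGroup
open Literature.NumberTheory.GaloisRepresentations Literature.NumberTheory.Rogawski1990
open scoped NNReal Matrix MatrixGroups

namespace Summit.HodgeConjecture.HodgeConjecture.Cruxes.H413.F0P3bInducedCharTransferLeviDictionary

variable (L : Type) [Field L] [NumberField L] [IsCMField L] (v : HeightOneSpectrum (𝓞 ↥(maximalRealSubfield L)))

/-! ## §0 The Levi datum: `g = diag(d′₀, d′₁) ∈ T₂`, `ι_v(γ_H) = diag(d′₀, u, d′₁) ∈ T₃` -/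

/-- `g = diag(d′₀, d′₁)` lies in the diagonal torus of `U(Φ₂)(L⁺_v)`. [cite: Rogawski1990, §12.1 p. 171] -/
theorem fst_mem_torusU_of_glDiagonal_eq
    {γH : (cmDatum L 2 (Matrix.of fun i j : Fin 2 => if i.val + j.val + 1 = 2 then (1 : L) else 0)).Local v ×
      (cmDatum L 1 (Matrix.of fun i j : Fin 1 => if i.val + j.val + 1 = 1 then (1 : L) else 0)).Local v}
    {d' : Fin 2 → (UnitaryGroup.LocalRing L v)ˣ} (hd' : glDiagonal 2 (UnitaryGroup.LocalRing L v) d' = (γH.1.val : GL (Fin 2) (UnitaryGroup.LocalRing L v))) :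
    (γH.1 : ↥(unitaryGroupOfForm (conjLocal L (IsCMField.complexConj L) v) (cmLocalForm L 2 v))) ∈
      torusU (conjLocal L (IsCMField.complexConj L) v) (cmLocalForm L 2 v) :=
  ⟨d', hd'⟩

/-! ## §1 (L3) The modulus dictionary -/

set_option maxHeartbeats 400000 in
/-- **THE MODULUS DICTIONARY OF LEMMA 4.9.2 ON THE LEVI STRATUM** (`unitModulusChar` currency): for `γ_H = (diag(d′₀, d′₁), u)` with `a − 1 = d′₀⁻¹u − 1` and
`b − 1 = d′₀⁻¹d′₁ − 1` units,
`δ_{B₂}^{1∕2}(g) · √‖b − 1‖ · D_{G∕H,v}(γ_H) = δ_B^{1∕2}(ι_v γ_H) · (‖a − 1‖ · √‖b − 1‖)` in `ℂ` — i.e. `δ_{B₂}^{1∕2} J₂⁻¹ D_{G∕H} = δ_B^{1∕2} J₃⁻¹` once ★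
`twistModule_cmLocal_two_eq` ∕ ★ `twistModule_cmLocal_eq` have rewritten the twist modules of ★ S0 FILE 2 ∕ FILE 2′; both sides equal `‖d′₀‖·‖a − 1‖·√‖b − 1‖`
(★ `rootDeltaChar_cmBorel_torus_two`, ★ `rootDeltaChar_cmBorel_torus`, ★ `sqrt_prod_norm_weylNumerator_cmLocal`).  Print: `|D_H(γ)|·|D_{G∕H}(γ)| = |D_G(γ)|`.
[cite: Rogawski1990, §4.9 Lemma 4.9.2 p. 56; §12.1 p. 171] -/
theorem rootDeltaChar_two_mul_sqrt_mul_finWeylRatio_eq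
    (γH : (cmDatum L 2 (Matrix.of fun i j : Fin 2 => if i.val + j.val + 1 = 2 then (1 : L) else 0)).Local v ×
      (cmDatum L 1 (Matrix.of fun i j : Fin 1 => if i.val + j.val + 1 = 1 then (1 : L) else 0)).Local v)
    {d' : Fin 2 → (UnitaryGroup.LocalRing L v)ˣ} (hd' : glDiagonal 2 (UnitaryGroup.LocalRing L v) d' = (γH.1.val : GL (Fin 2) (UnitaryGroup.LocalRing L v)))
    (ha : IsUnit ((((d' 0)⁻¹ * (isUnit_finGammaTwo L v γH).unit : (UnitaryGroup.LocalRing L v)ˣ) : UnitaryGroup.LocalRing L v) - 1))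
    (hb : IsUnit ((((d' 0)⁻¹ * d' 1 : (UnitaryGroup.LocalRing L v)ˣ) : UnitaryGroup.LocalRing L v) - 1)) :
    (haveI := locallyCompactSpace_cmBorelU L 2 v;
      ((rootDeltaChar (cmBorelTriple L 2 v).P
          ⟨(γH.1 : ↥(unitaryGroupOfForm (conjLocal L (IsCMField.complexConj L) v) (cmLocalForm L 2 v))),
            torusU_le_borelU _ _ (fst_mem_torusU_of_glDiagonal_eq L v hd')⟩ : ℂˣ) : ℂ)) *
        (((NNReal.sqrt (unitModulusChar (UnitaryGroup.LocalRing L v) hb.unit) : ℝ≥0) : ℝ) : ℂ) * (finWeylRatio L v γH : ℂ) =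
      (haveI := locallyCompactSpace_cmBorelU L 3 v;
        ((rootDeltaChar (cmBorelTriple L 3 v).P
            ⟨(endoEmbLocal L v γH : ↥(unitaryGroupOfForm (conjLocal L (IsCMField.complexConj L) v) (cmLocalForm L 3 v))),
              torusU_le_borelU _ _ (endoEmbLocal_mem_torusU_of_endoEmbLocal_eq L v γH (endoEmbLocal_eq_glDiagonal_of_fst_eq L v γH hd'))⟩ : ℂˣ) : ℂ)) *
        (((unitModulusChar (UnitaryGroup.LocalRing L v) ha.unit * NNReal.sqrt (unitModulusChar (UnitaryGroup.LocalRing L v) hb.unit) : ℝ≥0) : ℝ) : ℂ) := by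
  have hι := endoEmbLocal_eq_glDiagonal_of_fst_eq L v γH hd'
  have ht := endoEmbLocal_mem_torusU_of_endoEmbLocal_eq L v γH hι
  have ht₂ := fst_mem_torusU_of_glDiagonal_eq L v hd'
  -- `δ_{B₂}^{1∕2}(g) = √‖d′₀‖`
  have h2 := rootDeltaChar_cmBorel_torus_two L v ⟨_, ht₂⟩
  rw [torusEntry_eq_of_glDiagonal_eq (conjLocal L (IsCMField.complexConj L) v) (cmLocalForm L 2 v) 0 ⟨_, ht₂⟩ d' hd'] at h2
  -- `δ_B^{1∕2}(ι γ_H) = ‖d′₀‖`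
  have h3 := F0P2oBorelTorusModulus.rootDeltaChar_cmBorel_torus L v ⟨_, ht⟩
  rw [torusEntry_eq_of_glDiagonal_eq (conjLocal L (IsCMField.complexConj L) v) (cmLocalForm L 3 v) 0 ⟨_, ht⟩ _ hι.symm] at h3
  -- `D_{G∕H,v}(γ_H) = ‖a − 1‖ · √‖d′₀‖`
  have hD : finWeylRatio L v γH =
      ((unitModulusChar (UnitaryGroup.LocalRing L v) ha.unit : ℝ≥0) : ℝ) * Real.sqrt ((unitModulusChar (UnitaryGroup.LocalRing L v) (d' 0) : ℝ≥0) : ℝ) := by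
    unfold finWeylRatio
    rw [eval_finCharpolyTwo_eq_of_endoEmbLocal_eq L v γH hι]
    exact sqrt_prod_norm_weylNumerator_cmLocal L v ht hι.symm ha
  have h2' : (haveI := locallyCompactSpace_cmBorelU L 2 v;
      ((rootDeltaChar (cmBorelTriple L 2 v).P
          ⟨(γH.1 : ↥(unitaryGroupOfForm (conjLocal L (IsCMField.complexConj L) v) (cmLocalForm L 2 v))), torusU_le_borelU _ _ ht₂⟩ : ℂˣ) : ℂ)) =
      ((Real.sqrt ((unitModulusChar (UnitaryGroup.LocalRing L v) (d' 0) : ℝ≥0) : ℝ) : ℝ) : ℂ) := by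
    rw [h2, coe_halfModulusChar_apply, Real.coe_sqrt]
  simp only [Matrix.cons_val_zero] at h3
  rw [h2', h3, hD, NNReal.coe_mul, Real.coe_sqrt]
  -- the real identity `√x · √c · (b · √x) = x · (b · √c)`, `x = ‖d′₀‖`
  have hx : 0 ≤ ((unitModulusChar (UnitaryGroup.LocalRing L v) (d' 0) : ℝ≥0) : ℝ) := NNReal.coe_nonneg _
  have key : Real.sqrt ((unitModulusChar (UnitaryGroup.LocalRing L v) (d' 0) : ℝ≥0) : ℝ) *
      Real.sqrt ((unitModulusChar (UnitaryGroup.LocalRing L v) hb.unit : ℝ≥0) : ℝ) *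
        (((unitModulusChar (UnitaryGroup.LocalRing L v) ha.unit : ℝ≥0) : ℝ) * Real.sqrt ((unitModulusChar (UnitaryGroup.LocalRing L v) (d' 0) : ℝ≥0) : ℝ)) =
      ((unitModulusChar (UnitaryGroup.LocalRing L v) (d' 0) : ℝ≥0) : ℝ) *
        (((unitModulusChar (UnitaryGroup.LocalRing L v) ha.unit : ℝ≥0) : ℝ) * Real.sqrt ((unitModulusChar (UnitaryGroup.LocalRing L v) hb.unit : ℝ≥0) : ℝ)) := by
    rw [show Real.sqrt ((unitModulusChar (UnitaryGroup.LocalRing L v) (d' 0) : ℝ≥0) : ℝ) *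
        Real.sqrt ((unitModulusChar (UnitaryGroup.LocalRing L v) hb.unit : ℝ≥0) : ℝ) *
          (((unitModulusChar (UnitaryGroup.LocalRing L v) ha.unit : ℝ≥0) : ℝ) * Real.sqrt ((unitModulusChar (UnitaryGroup.LocalRing L v) (d' 0) : ℝ≥0) : ℝ)) =
        (Real.sqrt ((unitModulusChar (UnitaryGroup.LocalRing L v) (d' 0) : ℝ≥0) : ℝ) *
          Real.sqrt ((unitModulusChar (UnitaryGroup.LocalRing L v) (d' 0) : ℝ≥0) : ℝ)) *
          ((((unitModulusChar (UnitaryGroup.LocalRing L v) ha.unit : ℝ≥0) : ℝ)) * Real.sqrt ((unitModulusChar (UnitaryGroup.LocalRing L v) hb.unit : ℝ≥0) : ℝ)) by ring,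
      Real.mul_self_sqrt hx]
  exact_mod_cast key

/-! ## §2 (L2, EDITION 2) The character dictionary: `τ_v(γ_H) = μ_v(d′₀)` and `χ_H(γ_H) · τ_v(γ_H) = χ_ξ(ι_v γ_H)` -/

/-- Ring identity `(u − y)·σ(x) = u·σ(x − u)` under the torus relations `σ(x)y = 1`, `σ(u)u = 1` (local step: `u − d′₁` is a unit with `d′₀ − u`).
[cite: Rogawski1990, §4.9 p. 55] -/
private theorem sub_mul_map_eq_of_rel {R : Type*} [CommRing R] (σ : R →+* R) {x y u : R} (r2 : σ x * y = 1) (hu : σ u * u = 1) :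
    (u - y) * σ x = u * σ (x - u) := by
  rw [map_sub]; linear_combination hu - r2

/-- Ring identity `x·(x − u)·((u − y)·δ) = u·σ(u − x)·(u − x)` under `σ(x)y = 1`, `σ(u)u = 1`, `δx = σ(x)` (local step: the argument of `τ_v` on the stratum
is `u` times a norm, up to `d′₀`). [cite: Rogawski1990, §4.9 p. 55] -/
private theorem mul_sub_mul_eq_mul_norm_of_rel {R : Type*} [CommRing R] (σ : R →+* R) {x y u δ : R} (r2 : σ x * y = 1) (hu : σ u * u = 1)
    (hδx : δ * x = σ x) : x * ((x - u) * ((u - y) * δ)) = u * (σ (u - x) * (u - x)) := by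
  rw [map_sub]; linear_combination ((x - u) * (u - y)) * hδx - (x - u) * r2 - (u - x) * hu

/-- **Norm-triviality `μ_v(σ(z)·z) = 1`** for a unit `z` of `∏_{w∣v} L_w` when `μ|_{F_v^×} = ω` (★ `IsQuadraticCharExtension`: on `σ`-fixed units `μ_v = 1` exactly on
norms). [cite: Rogawski1990, §4.8 p. 51; §12.2 p. 173] -/
theorem finHeckeValue_conj_mul_self_eq_one (μ : HeckeCharacter L)
    (hμ : IsQuadraticCharExtension (conjLocal L (IsCMField.complexConj L) v) (μ.semilocalComponent L v)) {z : UnitaryGroup.LocalRing L v} (hz : IsUnit z) :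
    finHeckeValue L v μ (conjLocal L (IsCMField.complexConj L) v z * z) = 1 := by
  have hNu : IsUnit (conjLocal L (IsCMField.complexConj L) v z * z) := (hz.map _).mul hz
  rw [finHeckeValue_of_isUnit L v μ hNu]
  have hunit : hNu.unit = Units.map (conjLocal L (IsCMField.complexConj L) v : UnitaryGroup.LocalRing L v →* UnitaryGroup.LocalRing L v) hz.unit * hz.unit :=
    Units.ext (by rw [IsUnit.unit_spec, Units.val_mul, Units.coe_map, MonoidHom.coe_coe, IsUnit.unit_spec])
  have hfix : conjLocal L (IsCMField.complexConj L) v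
      ((Units.map (conjLocal L (IsCMField.complexConj L) v : UnitaryGroup.LocalRing L v →* UnitaryGroup.LocalRing L v) hz.unit * hz.unit :
        (UnitaryGroup.LocalRing L v)ˣ) : UnitaryGroup.LocalRing L v) =
      (Units.map (conjLocal L (IsCMField.complexConj L) v : UnitaryGroup.LocalRing L v →* UnitaryGroup.LocalRing L v) hz.unit * hz.unit :
        (UnitaryGroup.LocalRing L v)ˣ) := by
    rw [Units.val_mul, Units.coe_map, MonoidHom.coe_coe, map_mul, conjLocal_conjLocal_cm, mul_comm]
  rw [hunit, (hμ _ hfix).2 ⟨hz.unit, rfl⟩, Units.val_one]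

/-- **`τ_v(γ_H) = μ_v(d′₀)` ON THE LEVI STRATUM** («`τ(γ) = μ(γ₁)`» in the proof of Lemma 4.9.2): for `γ_H = (diag(d′₀, d′₁), u)` with `a − 1 = d′₀⁻¹u − 1`
a unit and `μ|_{F_v^×} = ω` (★ `IsQuadraticCharExtension`), `τ_v(γ_H) = μ_v(u)·μ_v(d′₀ − u)⁻¹·μ_v((u − d′₁)·det g⁻¹)⁻¹` (★ `finTau_eq_of_frame`, frame `P = 1`)
collapses to `μ_v(d′₀)`: with the torus relations `σ(d′₀)d′₁ = 1`, `σ(u)u = 1` (★ `torus_relations_two`, ★ `conjLocal_finGammaTwo_mul_finGammaTwo`) one has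
`det g⁻¹ · d′₀ = σ(d′₀)` and `d′₀ · (d′₀ − u) · ((u − d′₁)·det g⁻¹) = u · N(u − d′₀)`, `N = σ(·)(·)`, and `μ_v(N(u − d′₀)) = 1`.
[cite: Rogawski1990, §4.9 Lemma 4.9.2 p. 56; Prop. 4.9.1 p. 55; §4.8 p. 51] -/
theorem finTau_eq_finHeckeValue_of_levi (μ : HeckeCharacter L)
    (hμ : IsQuadraticCharExtension (conjLocal L (IsCMField.complexConj L) v) (μ.semilocalComponent L v))
    (γH : (cmDatum L 2 (Matrix.of fun i j : Fin 2 => if i.val + j.val + 1 = 2 then (1 : L) else 0)).Local v ×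
      (cmDatum L 1 (Matrix.of fun i j : Fin 1 => if i.val + j.val + 1 = 1 then (1 : L) else 0)).Local v)
    {d' : Fin 2 → (UnitaryGroup.LocalRing L v)ˣ} (hd' : glDiagonal 2 (UnitaryGroup.LocalRing L v) d' = (γH.1.val : GL (Fin 2) (UnitaryGroup.LocalRing L v)))
    (ha : IsUnit ((((d' 0)⁻¹ * (isUnit_finGammaTwo L v γH).unit : (UnitaryGroup.LocalRing L v)ˣ) : UnitaryGroup.LocalRing L v) - 1)) :
    finTau L v γH μ = finHeckeValue L v μ (d' 0 : UnitaryGroup.LocalRing L v) := by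
  have ht₂ := fst_mem_torusU_of_glDiagonal_eq L v hd'
  obtain ⟨_, r2⟩ := LineRing.torus_relations_two (conjLocal L (IsCMField.complexConj L) v) (cmLocalForm_eq_over L 2 v) ⟨_, ht₂⟩ hd'
  have hu := conjLocal_finGammaTwo_mul_finGammaTwo L v γH
  -- the frame `g · 1 = 1 · diag(d′₀, d′₁)`
  have ht : (γH.1.val.val : Matrix (Fin 2) (Fin 2) (UnitaryGroup.LocalRing L v)) * (1 : GL (Fin 2) (UnitaryGroup.LocalRing L v)).val =
      (1 : GL (Fin 2) (UnitaryGroup.LocalRing L v)).val * diagonal ![(d' 0 : UnitaryGroup.LocalRing L v), d' 1] := by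
    rw [Units.val_one, Matrix.mul_one, Matrix.one_mul, ← hd', coe_glDiagonal]
    congr 1; funext i; fin_cases i <;> rfl
  -- `det g = d′₀ d′₁`, `det g⁻¹ · (d′₀ d′₁) = 1`, `det g⁻¹ · d′₀ = σ(d′₀)`
  have hdet : (γH.1.val.val : Matrix (Fin 2) (Fin 2) (UnitaryGroup.LocalRing L v)).det = (d' 0 : UnitaryGroup.LocalRing L v) * d' 1 := by
    rw [← hd', coe_glDiagonal, Matrix.det_diagonal, Fin.prod_univ_two]
  have hδ : ((γH.1.val⁻¹).val : Matrix (Fin 2) (Fin 2) (UnitaryGroup.LocalRing L v)).det * ((d' 0 : UnitaryGroup.LocalRing L v) * d' 1) = 1 := by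
    have h1 : ((γH.1.val⁻¹).val : Matrix (Fin 2) (Fin 2) (UnitaryGroup.LocalRing L v)) * γH.1.val.val = 1 := by
      rw [← Units.val_mul, inv_mul_cancel, Units.val_one]
    have h2 := congrArg Matrix.det h1
    rw [Matrix.det_mul, Matrix.det_one, hdet] at h2
    exact h2
  have hδx : ((γH.1.val⁻¹).val : Matrix (Fin 2) (Fin 2) (UnitaryGroup.LocalRing L v)).det * (d' 0 : UnitaryGroup.LocalRing L v) =
      conjLocal L (IsCMField.complexConj L) v (d' 0 : UnitaryGroup.LocalRing L v) := by
    calc ((γH.1.val⁻¹).val : Matrix (Fin 2) (Fin 2) (UnitaryGroup.LocalRing L v)).det * (d' 0 : UnitaryGroup.LocalRing L v)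
        = ((γH.1.val⁻¹).val : Matrix (Fin 2) (Fin 2) (UnitaryGroup.LocalRing L v)).det * (d' 0 : UnitaryGroup.LocalRing L v) *
            (conjLocal L (IsCMField.complexConj L) v (d' 0 : UnitaryGroup.LocalRing L v) * d' 1) := by rw [r2, mul_one]
      _ = conjLocal L (IsCMField.complexConj L) v (d' 0 : UnitaryGroup.LocalRing L v) *
            (((γH.1.val⁻¹).val : Matrix (Fin 2) (Fin 2) (UnitaryGroup.LocalRing L v)).det * ((d' 0 : UnitaryGroup.LocalRing L v) * d' 1)) := by ring
      _ = conjLocal L (IsCMField.complexConj L) v (d' 0 : UnitaryGroup.LocalRing L v) := by rw [hδ, mul_one]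
  -- units
  have hx : IsUnit (d' 0 : UnitaryGroup.LocalRing L v) := (d' 0).isUnit
  have huU : IsUnit (finGammaTwo L v γH) := isUnit_finGammaTwo L v γH
  have hux : IsUnit (finGammaTwo L v γH - (d' 0 : UnitaryGroup.LocalRing L v)) := by
    have h : (d' 0 : UnitaryGroup.LocalRing L v) * ((((d' 0)⁻¹ * (isUnit_finGammaTwo L v γH).unit : (UnitaryGroup.LocalRing L v)ˣ) : UnitaryGroup.LocalRing L v) - 1) =
        finGammaTwo L v γH - (d' 0 : UnitaryGroup.LocalRing L v) := by
      rw [Units.val_mul, IsUnit.unit_spec, mul_sub, mul_one, ← mul_assoc, Units.mul_inv, one_mul]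
    rw [← h]; exact hx.mul ha
  have hxu : IsUnit ((d' 0 : UnitaryGroup.LocalRing L v) - finGammaTwo L v γH) := by rw [← neg_sub]; exact hux.neg
  have hδu : IsUnit ((γH.1.val⁻¹).val : Matrix (Fin 2) (Fin 2) (UnitaryGroup.LocalRing L v)).det := Matrix.isUnits_det_units _
  have huy : IsUnit (finGammaTwo L v γH - (d' 1 : UnitaryGroup.LocalRing L v)) :=
    isUnit_of_mul_isUnit_left (y := conjLocal L (IsCMField.complexConj L) v (d' 0 : UnitaryGroup.LocalRing L v))
      (by rw [sub_mul_map_eq_of_rel (conjLocal L (IsCMField.complexConj L) v) r2 hu]; exact huU.mul (hxu.map _))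
  have hq : IsUnit ((finGammaTwo L v γH - (d' 1 : UnitaryGroup.LocalRing L v)) * ((γH.1.val⁻¹).val : Matrix (Fin 2) (Fin 2) (UnitaryGroup.LocalRing L v)).det) :=
    huy.mul hδu
  -- `μ_v` through the ring identity `d′₀ (d′₀ − u)((u − d′₁)δ) = u · N(u − d′₀)` and norm-triviality
  have hval : finHeckeValue L v μ (d' 0 : UnitaryGroup.LocalRing L v) *
      (finHeckeValue L v μ ((d' 0 : UnitaryGroup.LocalRing L v) - finGammaTwo L v γH) *
        finHeckeValue L v μ ((finGammaTwo L v γH - (d' 1 : UnitaryGroup.LocalRing L v)) * ((γH.1.val⁻¹).val : Matrix (Fin 2) (Fin 2) (UnitaryGroup.LocalRing L v)).det)) =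
      finHeckeValue L v μ (finGammaTwo L v γH) := by
    rw [← finHeckeValue_mul L v μ hxu hq, ← finHeckeValue_mul L v μ hx (hxu.mul hq), mul_sub_mul_eq_mul_norm_of_rel (conjLocal L (IsCMField.complexConj L) v) r2 hu hδx,
      finHeckeValue_mul L v μ huU ((hux.map _).mul hux), finHeckeValue_conj_mul_self_eq_one L v μ hμ hux, mul_one]
  rw [finTau_eq_of_frame μ 1 ht hxu hq, ← hval, mul_assoc, mul_mul_mul_comm, mul_inv_cancel₀ (finHeckeValue_ne_zero_of_isUnit L v μ hxu),
    mul_inv_cancel₀ (finHeckeValue_ne_zero_of_isUnit L v μ hq), mul_one, mul_one]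

/-- The character identity on abstract torus points (local step, small goal): `χ_{H,2}(t₂) · ψ(ℓ) · μ_v(x) = χ_ξ(t₃)` whenever `t₂`, `t₃` have first entry `x`
and `det t₂ · ℓ = det t₃` in `E¹`. [cite: Rogawski1990, §12.1 p. 171; §12.2 p. 174] -/
private theorem torusCharPair_mul_mul_eq_cmXiTorusChar_aux (μv : (UnitaryGroup.LocalRing L v)ˣ →* ℂˣ)
    (η ψ : ↥(normOneUnits (conjLocal L (IsCMField.complexConj L) v)) →* ℂˣ)
    (t₂ : ↥(torusU (conjLocal L (IsCMField.complexConj L) v) (cmLocalForm L 2 v))) (t₃ : ↥(torusU (conjLocal L (IsCMField.complexConj L) v) (cmLocalForm L 3 v)))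
    (ℓ : ↥(normOneUnits (conjLocal L (IsCMField.complexConj L) v))) (x : (UnitaryGroup.LocalRing L v)ˣ)
    (hE₂ : torusEntry (conjLocal L (IsCMField.complexConj L) v) (cmLocalForm L 2 v) 0 t₂ = x)
    (hE₃ : torusEntry (conjLocal L (IsCMField.complexConj L) v) (cmLocalForm L 3 v) 0 t₃ = x)
    (hψ : torusDetNormOne (conjLocal L (IsCMField.complexConj L) v) (cmLocalForm L 2 v) (cmLocalForm_eq_over L 2 v) t₂ * ℓ =
      torusDetNormOne (conjLocal L (IsCMField.complexConj L) v) (cmLocalForm L 3 v) (cmLocalForm_eq_over L 3 v) t₃) :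
    ((torusCharPair (conjLocal L (IsCMField.complexConj L) v) (cmLocalForm L 2 v) (cmLocalForm_eq_over L 2 v) 0
          ((η.comp (quotConj (conjLocal L (IsCMField.complexConj L) v) (conjLocal_conjLocal_cm L v))) * halfModulusChar (UnitaryGroup.LocalRing L v)) ψ t₂ : ℂˣ) : ℂ) *
        ((ψ ℓ : ℂˣ) : ℂ) * ((μv x : ℂˣ) : ℂ) = ((cmXiTorusChar L v μv η ψ t₃ : ℂˣ) : ℂ) := by
  -- (`simp only`, not `rw`: its discrimination-tree matching never tries to unify the rank-`2` and rank-`3` torus objects with each other)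
  have hψ' : ((ψ (torusDetNormOne (conjLocal L (IsCMField.complexConj L) v) (cmLocalForm L 2 v) (cmLocalForm_eq_over L 2 v) t₂) : ℂˣ) : ℂ) * ((ψ ℓ : ℂˣ) : ℂ) =
      ((ψ (torusDetNormOne (conjLocal L (IsCMField.complexConj L) v) (cmLocalForm L 3 v) (cmLocalForm_eq_over L 3 v) t₃) : ℂˣ) : ℂ) := by
    rw [← Units.val_mul, ← map_mul, hψ]
  simp only [torusCharPair_apply, cmXiTorusChar, xiTorusChar_apply, hE₂, hE₃, MonoidHom.mul_apply, MonoidHom.comp_apply, Units.val_mul, ← hψ']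
  ring

/-- **THE CHARACTER DICTIONARY OF LEMMA 4.9.2 ON THE LEVI STRATUM**: with the `H`-side torus character of the line's stub (N-492),
`χ_{H,2} = torusCharPair … 0 ((η ∘ quotConj) · ‖·‖^{1∕2}) ψ` on `U(Φ₂)` and `ψ ∘ det` on `U(Φ₁)`, and the `G`-side `χ_ξ = cmXiTorusChar L v μ_v η ψ`:
`χ_{H,2}(g) · ψ(det u) · τ_v(γ_H) = χ_ξ(ι_v γ_H)` for `γ_H = (g, u) = (diag(d′₀, d′₁), u)` on the stratum (`a − 1` a unit, `μ|_{F_v^×} = ω`) — both sides are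
`η(d′₀∕σd′₀) · ‖d′₀‖^{1∕2} · ψ(d′₀ u d′₁) · μ_v(d′₀)` («by functoriality `ξ_H` carries `i_H(χ)` to `i_G(χμ)`»; `τ(γ) = μ(γ₁)` by ★ `finTau_eq_finHeckeValue_of_levi`).
[cite: Rogawski1990, §4.9 Lemma 4.9.2 p. 56; §12.2 p. 174; §12.1 p. 171] -/
theorem torusCharPair_mul_localDet_mul_finTau_eq_cmXiTorusChar (μ : HeckeCharacter L)
    (hμ : IsQuadraticCharExtension (conjLocal L (IsCMField.complexConj L) v) (μ.semilocalComponent L v))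
    (η ψ : ↥(normOneUnits (conjLocal L (IsCMField.complexConj L) v)) →* ℂˣ)
    (γH : (cmDatum L 2 (Matrix.of fun i j : Fin 2 => if i.val + j.val + 1 = 2 then (1 : L) else 0)).Local v ×
      (cmDatum L 1 (Matrix.of fun i j : Fin 1 => if i.val + j.val + 1 = 1 then (1 : L) else 0)).Local v)
    {d' : Fin 2 → (UnitaryGroup.LocalRing L v)ˣ} (hd' : glDiagonal 2 (UnitaryGroup.LocalRing L v) d' = (γH.1.val : GL (Fin 2) (UnitaryGroup.LocalRing L v)))
    (ha : IsUnit ((((d' 0)⁻¹ * (isUnit_finGammaTwo L v γH).unit : (UnitaryGroup.LocalRing L v)ˣ) : UnitaryGroup.LocalRing L v) - 1)) :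
    ((torusCharPair (conjLocal L (IsCMField.complexConj L) v) (cmLocalForm L 2 v) (cmLocalForm_eq_over L 2 v) 0
          ((η.comp (quotConj (conjLocal L (IsCMField.complexConj L) v) (conjLocal_conjLocal_cm L v))) * halfModulusChar (UnitaryGroup.LocalRing L v)) ψ
          ⟨(γH.1 : ↥(unitaryGroupOfForm (conjLocal L (IsCMField.complexConj L) v) (cmLocalForm L 2 v))), fst_mem_torusU_of_glDiagonal_eq L v hd'⟩ : ℂˣ) : ℂ) *
        ((ψ (localDet (IsCMField.complexConj L) v (isUnit_antidiagOne_det L 1) γH.2) : ℂˣ) : ℂ) * finTau L v γH μ =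
      ((cmXiTorusChar L v (μ.semilocalComponent L v) η ψ
          ⟨(endoEmbLocal L v γH : ↥(unitaryGroupOfForm (conjLocal L (IsCMField.complexConj L) v) (cmLocalForm L 3 v))),
            endoEmbLocal_mem_torusU_of_endoEmbLocal_eq L v γH (endoEmbLocal_eq_glDiagonal_of_fst_eq L v γH hd')⟩ : ℂˣ) : ℂ) := by
  have hι := endoEmbLocal_eq_glDiagonal_of_fst_eq L v γH hd'
  have ht := endoEmbLocal_mem_torusU_of_endoEmbLocal_eq L v γH hι
  have ht₂ := fst_mem_torusU_of_glDiagonal_eq L v hd'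
  have hE₂ : torusEntry (conjLocal L (IsCMField.complexConj L) v) (cmLocalForm L 2 v) 0 ⟨_, ht₂⟩ = d' 0 :=
    torusEntry_eq_of_glDiagonal_eq _ _ 0 ⟨_, ht₂⟩ d' hd'
  have hE₃ : torusEntry (conjLocal L (IsCMField.complexConj L) v) (cmLocalForm L 3 v) 0 ⟨_, ht⟩ = d' 0 := by
    rw [torusEntry_eq_of_glDiagonal_eq _ _ 0 ⟨_, ht⟩ _ hι.symm, Matrix.cons_val_zero]
  -- `det g · det u = det ι_v γ_H` in `E¹` (each rank separately, then units; no `rw` across ranks)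
  have h2 : torusDet (conjLocal L (IsCMField.complexConj L) v) (cmLocalForm L 2 v) ⟨_, ht₂⟩ = ∏ j, d' j :=
    torusDet_eq_of_glDiagonal_eq _ _ ⟨_, ht₂⟩ d' hd'
  have h3 : torusDet (conjLocal L (IsCMField.complexConj L) v) (cmLocalForm L 3 v) ⟨_, ht⟩ = ∏ j, ![d' 0, (isUnit_finGammaTwo L v γH).unit, d' 1] j :=
    torusDet_eq_of_glDiagonal_eq _ _ ⟨_, ht⟩ _ hι.symm
  have hprod : (∏ j, d' j) * ((localDet (IsCMField.complexConj L) v (isUnit_antidiagOne_det L 1) γH.2 :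
      ↥(normOneUnits (conjLocal L (IsCMField.complexConj L) v))) : (UnitaryGroup.LocalRing L v)ˣ) = ∏ j, ![d' 0, (isUnit_finGammaTwo L v γH).unit, d' 1] j := by
    rw [Fin.prod_univ_two, Fin.prod_univ_three, coe_localDet]
    refine Units.ext ?_
    simp only [Units.val_mul, Matrix.GeneralLinearGroup.val_det_apply, Matrix.det_fin_one, Matrix.cons_val_zero, Matrix.cons_val_one,
      Matrix.cons_val_two, Matrix.head_cons, Matrix.tail_cons, IsUnit.unit_spec, finGammaTwo]
    ring
  have hψ : torusDetNormOne (conjLocal L (IsCMField.complexConj L) v) (cmLocalForm L 2 v) (cmLocalForm_eq_over L 2 v) ⟨_, ht₂⟩ *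
      localDet (IsCMField.complexConj L) v (isUnit_antidiagOne_det L 1) γH.2 =
      torusDetNormOne (conjLocal L (IsCMField.complexConj L) v) (cmLocalForm L 3 v) (cmLocalForm_eq_over L 3 v) ⟨_, ht⟩ :=
    Subtype.ext (by simp only [Subgroup.coe_mul, coe_torusDetNormOne, h2, h3]; exact hprod)
  have hτ := finTau_eq_finHeckeValue_of_levi L v μ hμ γH hd' ha
  rw [finHeckeValue_of_isUnit L v μ (d' 0).isUnit, IsUnit.unit_of_val_units] at hτ
  rw [hτ]
  exact torusCharPair_mul_mul_eq_cmXiTorusChar_aux L v (μ.semilocalComponent L v) η ψ ⟨_, ht₂⟩ ⟨_, ht⟩ _ (d' 0) hE₂ hE₃ hψ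

end Summit.HodgeConjecture.HodgeConjecture.Cruxes.H413.F0P3bInducedCharTransferLeviDictionary

end
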